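import Literature.NumberTheory.DiophantineGeometry.AbcDarmonGranvilleBelyiMapReduction
import HarnessLib

/-!
# Darmon–Granville's Theorem 2: reduction to minimal signatures

Topic: `Literature/NumberTheory/DiophantineGeometry`. Theorem-only file (no definition, no named
fact) in the chain attached to the named fact `AbcWave0.darmonGranville1995_thm_2`
(Darmon–Granville 1995, Theorem 2: for `1/p + 1/q + 1/r < 1` the generalized Fermat equation
`A x^p + B y^q = C z^r` has finitely many proper solutions). The tree proves Theorem 2 from Faltings'
theorem and one covering of `ℙ¹` of signature `(p, q, r)` over a number field FOR EVERY hyperbolic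
`(p, q, r)` (`darmonGranville1995_thm_2_of_belyiMap_of_faltings`, `AbcDarmonGranvilleBelyiMapReduction`;
the covering is the Riemann-existence input of [cite: DarmonGranville1995, Prop. 3.1],
[cite: BombieriGubler2006, Cor. 12.6.7]). This file records two elementary reductions on the side of
the Diophantine equation which shrink that input to the **minimal** hyperbolic signatures:

* **Divisibility** (`finite_properSolutions_of_dvd`): if `p' ∣ p`, `q' ∣ q`, `r' ∣ r`, a proper solution
  `(x, y, z)` of signature `(p, q, r)` gives the proper solution `(x^{p/p'}, y^{q/q'}, z^{r/r'})` of
  signature `(p', q', r')` with the same coefficients, and `x ↦ x^a` (`a ≥ 1`) has finite fibres on `ℤ`;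
  so finiteness for `(p', q', r')` implies finiteness for `(p, q, r)`.
* **Permutations** (`finite_properSolutions_swap₁₂`, `finite_properSolutions_swap₂₃`):
  `A x^p + B y^q = C z^r ⟺ B y^q + A x^p = C z^r ⟺ A x^p + (-C) z^r = (-B) y^q`, so finiteness for all
  non-zero coefficients is invariant under permuting `(p, q, r)`.

Consequently (`darmonGranville1995_thm_2_of_minimal_belyiMaps_of_faltings`) Theorem 2 follows from
Faltings' theorem (the named fact `finite_ratPlaces_of_two_le_genus`) and the existence of a
`(p, q, r)` covering only for the hyperbolic signatures `p ≤ q ≤ r` that are MINIMAL for coordinatewise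
divisibility (no hyperbolic `(p', q', r') ≠ (p, q, r)` with `p' ∣ p, q' ∣ q, r' ∣ r`): e.g. `(2, 3, ℓ)`
for the primes `ℓ ≥ 7` and `ℓ ∈ {8, 9, 10, 12, 15, 25}`, `(2, 4, ℓ)` for primes `ℓ ≥ 5` and
`ℓ ∈ {6, 8, 9}`, `(3, 3, ℓ)` for primes `ℓ ≥ 5` and `ℓ ∈ {4, 6, 9}`, `(4, 4, 4)`, `(5, 5, 5)`, and every
hyperbolic triple of primes. The per-signature form of the tree's assembly used on the way,
`finite_properSolutions_of_belyiMap_of_faltings` (ONE hyperbolic signature: a `(p, q, r)` covering over a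
number field and Faltings' theorem give finiteness for all non-zero `A, B, C`), is the statement one
instantiates with an explicit covering (e.g. the Fermat function field for `(n, n, n)`).

These reductions are not in the printed proof, which treats all signatures uniformly through the
Riemann existence theorem; they are bookkeeping towards replacing that input by explicit coverings
where such exist. Nothing here changes a statement of `AbcWave0`; no definition is introduced (the
solution sets are written out as terms, as in `AbcDarmonGranvilleCoeffProofs`).

## References

* H. Darmon, A. Granville, *On the equations `z^m = F(x, y)` and `A x^p + B y^q = C z^r`*, Bull. London
  Math. Soc. 27 (1995) 513–543: Theorem 2 (p. 515), Prop. 3.1 (p. 525), proof of Theorem 2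
  (pp. 526–527). [DarmonGranville1995]
* E. Bombieri, W. Gubler, *Heights in Diophantine Geometry*, CUP 2006: Cor. 12.6.7, Thm. 12.6.15.
  [BombieriGubler2006]
-/

noncomputable section

open scoped Classical Polynomial IntermediateField NumberField

namespace Literature.NumberTheory.DiophantineGeometry

open Polynomial IsDedekindDomain NumberField WithZero AlgFunctionField

/-- `Hyp(p, q, r)`: the hyperbolicity test `q r + r p + p q < p q r` of `darmonGranville1995_thm_2`
(local notation of this file only). -/
local notation3 "Hyp(" p ", " q ", " r ")" => (q * r + r * p + p * q < p * q * r : Prop)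

/-- `FinAll(p, q, r)`: for all non-zero `A, B, C` the proper solutions of `A x^p + B y^q = C z^r` are
finitely many — the conclusion of `darmonGranville1995_thm_2` at one signature (local notation of this
file only). -/
local notation3 "FinAll(" p ", " q ", " r ")" =>
  (∀ A B C : ℤ, A ≠ 0 → B ≠ 0 → C ≠ 0 →
    Set.Finite {t : ℤ × ℤ × ℤ | ({t.1, t.2.1, t.2.2} : Finset ℤ).gcd id = 1 ∧
      A * t.1 ^ (p : ℕ) + B * t.2.1 ^ (q : ℕ) = C * t.2.2 ^ (r : ℕ)} : Prop)

/-- `Min(p, q, r)`: `(p, q, r)` is minimal among hyperbolic signatures for coordinatewise divisibility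
(local notation of this file only). -/
local notation3 "Min(" p ", " q ", " r ")" =>
  (∀ p' q' r' : ℕ, p' ∣ (p : ℕ) → q' ∣ (q : ℕ) → r' ∣ (r : ℕ) →
    q' * r' + r' * p' + p' * q' < p' * q' * r' → p' = p ∧ q' = q ∧ r' = r : Prop)

/-! ### A. Divisibility of signatures -/

section Divisibility

/-- Powers of a proper triple form a proper triple: `gcd(x, y, z) = 1 ⇒ gcd(x^a, y^b, z^c) = 1`
(a prime dividing the three powers divides `x, y, z`). [folklore] -/
theorem gcd_pow_eq_one_of_gcd_eq_one {x y z : ℤ} (h : ({x, y, z} : Finset ℤ).gcd id = 1)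
    (a b c : ℕ) : ({x ^ a, y ^ b, z ^ c} : Finset ℤ).gcd id = 1 := by
  set g := ({x ^ a, y ^ b, z ^ c} : Finset ℤ).gcd id with hg
  have hgx : g ∣ x ^ a := Finset.gcd_dvd (f := id) (by simp)
  have hgy : g ∣ y ^ b := Finset.gcd_dvd (f := id) (by simp)
  have hgz : g ∣ z ^ c := Finset.gcd_dvd (f := id) (by simp)
  by_contra hne
  have hne' : g.natAbs ≠ 1 := by
    intro h1
    have hu : IsUnit g := Int.isUnit_iff_natAbs_eq.mpr h1
    apply hne
    rw [hg, ← Finset.normalize_gcd, normalize_eq_one]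
    exact hu
  obtain ⟨ℓ, hℓ, hℓg⟩ := Int.exists_prime_and_dvd hne'
  exact hℓ.not_unit (isUnit_of_dvd_of_gcd_eq_one h (hℓ.dvd_of_dvd_pow (hℓg.trans hgx))
    (hℓ.dvd_of_dvd_pow (hℓg.trans hgy)) (hℓ.dvd_of_dvd_pow (hℓg.trans hgz)))

/-- `x ↦ x^a` (`a ≥ 1`) does not decrease absolute values on `ℤ`: `x^a = u ⇒ |x| ≤ |u|`. [folklore] -/
theorem abs_le_abs_of_pow_eq {x u : ℤ} {a : ℕ} (ha : a ≠ 0) (h : x ^ a = u) : |x| ≤ |u| := by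
  rcases eq_or_ne x 0 with rfl | hx
  · rw [abs_zero]; exact abs_nonneg u
  · calc |x| ≤ |x| ^ a := le_self_pow₀ (Int.one_le_abs hx) ha
      _ = |u| := by rw [← abs_pow, h]

/-- **Divisibility reduction.** If `p' ∣ p`, `q' ∣ q`, `r' ∣ r` (`p, q, r ≠ 0`) and the proper solutions
of `A x^{p'} + B y^{q'} = C z^{r'}` are finitely many, so are those of `A x^p + B y^q = C z^r`: the map
`(x, y, z) ↦ (x^{p/p'}, y^{q/q'}, z^{r/r'})` sends the latter to the former
(`gcd_pow_eq_one_of_gcd_eq_one`) and has finite fibres (`abs_le_abs_of_pow_eq`). [folklore] -/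
theorem finite_properSolutions_of_dvd {A B C : ℤ} {p q r p' q' r' : ℕ}
    (hp : p' ∣ p) (hq : q' ∣ q) (hr : r' ∣ r) (hp0 : p ≠ 0) (hq0 : q ≠ 0) (hr0 : r ≠ 0)
    (h : {t : ℤ × ℤ × ℤ | ({t.1, t.2.1, t.2.2} : Finset ℤ).gcd id = 1 ∧
      A * t.1 ^ p' + B * t.2.1 ^ q' = C * t.2.2 ^ r'}.Finite) :
    {t : ℤ × ℤ × ℤ | ({t.1, t.2.1, t.2.2} : Finset ℤ).gcd id = 1 ∧
      A * t.1 ^ p + B * t.2.1 ^ q = C * t.2.2 ^ r}.Finite := by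
  obtain ⟨a, rfl⟩ := hp
  obtain ⟨b, rfl⟩ := hq
  obtain ⟨c, rfl⟩ := hr
  have ha : a ≠ 0 := fun h0 => hp0 (by rw [h0, mul_zero])
  have hb : b ≠ 0 := fun h0 => hq0 (by rw [h0, mul_zero])
  have hc : c ≠ 0 := fun h0 => hr0 (by rw [h0, mul_zero])
  -- `Φ (x, y, z) = (x^a, y^b, z^c)` has finite fibres
  let Φ : ℤ × ℤ × ℤ → ℤ × ℤ × ℤ := fun t => (t.1 ^ a, t.2.1 ^ b, t.2.2 ^ c)
  have hfib : ∀ s : ℤ × ℤ × ℤ, (Φ ⁻¹' {s}).Finite := by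
    rintro ⟨u, v, w⟩
    refine (finite_abs_le_box3 (|u| + |v| + |w|)).subset ?_
    rintro ⟨x, y, z⟩ hxyz
    simp only [Set.mem_preimage, Set.mem_singleton_iff, Φ, Prod.mk.injEq] at hxyz
    obtain ⟨hu, hv, hw⟩ := hxyz
    have h1 := abs_le_abs_of_pow_eq ha hu
    have h2 := abs_le_abs_of_pow_eq hb hv
    have h3 := abs_le_abs_of_pow_eq hc hw
    have hu0 := abs_nonneg u
    have hv0 := abs_nonneg v
    have hw0 := abs_nonneg w
    exact ⟨by linarith, by linarith, by linarith⟩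
  -- and maps proper solutions of signature `(p' a, q' b, r' c)` to proper solutions of `(p', q', r')`
  refine (h.preimage' fun s _ => hfib s).subset ?_
  rintro ⟨x, y, z⟩ ⟨hg, he⟩
  dsimp only at hg he
  simp only [Set.mem_preimage, Set.mem_setOf_eq, Φ]
  refine ⟨gcd_pow_eq_one_of_gcd_eq_one hg a b c, ?_⟩
  rw [← pow_mul, ← pow_mul, ← pow_mul, mul_comm a, mul_comm b, mul_comm c]
  exact he

/-- **Divisibility reduction, all coefficients.** `FinAll(p', q', r') ⇒ FinAll(p, q, r)` for
`p' ∣ p`, `q' ∣ q`, `r' ∣ r`, `p q r ≠ 0`. [folklore] -/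
theorem forall_finite_properSolutions_of_dvd {p q r p' q' r' : ℕ}
    (hp : p' ∣ p) (hq : q' ∣ q) (hr : r' ∣ r) (hp0 : p ≠ 0) (hq0 : q ≠ 0) (hr0 : r ≠ 0)
    (h : FinAll(p', q', r')) : FinAll(p, q, r) :=
  fun _ _ _ hA hB hC => finite_properSolutions_of_dvd hp hq hr hp0 hq0 hr0 (h _ _ _ hA hB hC)

end Divisibility

/-! ### B. Permutations of signatures -/

section Permutations

/-- **Swapping the first two terms**: `A x^p + B y^q = C z^r ⟺ B y^q + A x^p = C z^r`, so the proper
solutions of signature `(p, q, r)` for `(A, B, C)` are the images under `(x, y, z) ↦ (y, x, z)` of those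
of signature `(q, p, r)` for `(B, A, C)`. [folklore] -/
theorem finite_properSolutions_swap₁₂ {A B C : ℤ} {p q r : ℕ}
    (h : {t : ℤ × ℤ × ℤ | ({t.1, t.2.1, t.2.2} : Finset ℤ).gcd id = 1 ∧
      B * t.1 ^ q + A * t.2.1 ^ p = C * t.2.2 ^ r}.Finite) :
    {t : ℤ × ℤ × ℤ | ({t.1, t.2.1, t.2.2} : Finset ℤ).gcd id = 1 ∧
      A * t.1 ^ p + B * t.2.1 ^ q = C * t.2.2 ^ r}.Finite := by
  let Φ : ℤ × ℤ × ℤ → ℤ × ℤ × ℤ := fun t => (t.2.1, t.1, t.2.2)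
  have hΦ : Function.Injective Φ := by
    rintro ⟨x, y, z⟩ ⟨x', y', z'⟩ hh
    simp only [Φ, Prod.mk.injEq] at hh
    obtain ⟨h1, h2, h3⟩ := hh
    rw [h1, h2, h3]
  refine (h.preimage hΦ.injOn).subset ?_
  rintro ⟨x, y, z⟩ ⟨hg, he⟩
  dsimp only at hg he
  simp only [Set.mem_preimage, Set.mem_setOf_eq, Φ]
  refine ⟨?_, by linear_combination he⟩
  rwa [Finset.insert_comm]

/-- **Swapping the last two terms**: `A x^p + B y^q = C z^r ⟺ A x^p + (-C) z^r = (-B) y^q`, so the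
proper solutions of signature `(p, q, r)` for `(A, B, C)` are the images under `(x, y, z) ↦ (x, z, y)` of
those of signature `(p, r, q)` for `(A, -C, -B)`. [folklore] -/
theorem finite_properSolutions_swap₂₃ {A B C : ℤ} {p q r : ℕ}
    (h : {t : ℤ × ℤ × ℤ | ({t.1, t.2.1, t.2.2} : Finset ℤ).gcd id = 1 ∧
      A * t.1 ^ p + (-C) * t.2.1 ^ r = (-B) * t.2.2 ^ q}.Finite) :
    {t : ℤ × ℤ × ℤ | ({t.1, t.2.1, t.2.2} : Finset ℤ).gcd id = 1 ∧
      A * t.1 ^ p + B * t.2.1 ^ q = C * t.2.2 ^ r}.Finite := by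
  let Φ : ℤ × ℤ × ℤ → ℤ × ℤ × ℤ := fun t => (t.1, t.2.2, t.2.1)
  have hΦ : Function.Injective Φ := by
    rintro ⟨x, y, z⟩ ⟨x', y', z'⟩ hh
    simp only [Φ, Prod.mk.injEq] at hh
    obtain ⟨h1, h2, h3⟩ := hh
    rw [h1, h2, h3]
  refine (h.preimage hΦ.injOn).subset ?_
  rintro ⟨x, y, z⟩ ⟨hg, he⟩
  dsimp only at hg he
  simp only [Set.mem_preimage, Set.mem_setOf_eq, Φ]
  refine ⟨?_, by linear_combination he⟩
  rwa [Finset.pair_comm]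

/-- `FinAll(q, p, r) ⇒ FinAll(p, q, r)`. [folklore] -/
theorem forall_finite_properSolutions_swap₁₂ {p q r : ℕ} (h : FinAll(q, p, r)) : FinAll(p, q, r) :=
  fun A B C hA hB hC => finite_properSolutions_swap₁₂ (h B A C hB hA hC)

/-- `FinAll(p, r, q) ⇒ FinAll(p, q, r)`. [folklore] -/
theorem forall_finite_properSolutions_swap₂₃ {p q r : ℕ} (h : FinAll(p, r, q)) : FinAll(p, q, r) :=
  fun A B C hA hB hC =>
    finite_properSolutions_swap₂₃ (h A (-C) (-B) hA (neg_ne_zero.mpr hC) (neg_ne_zero.mpr hB))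

/-- The hyperbolicity test is symmetric: `Hyp(p, q, r) ⇒ Hyp(q, p, r)`. [folklore] -/
theorem hyperbolic_swap₁₂ {p q r : ℕ} (h : Hyp(p, q, r)) : Hyp(q, p, r) := by
  have e1 : p * r + r * q + q * p = q * r + r * p + p * q := by ring
  have e2 : q * p * r = p * q * r := by ring
  rw [e1, e2]; exact h

/-- The hyperbolicity test is symmetric: `Hyp(p, q, r) ⇒ Hyp(p, r, q)`. [folklore] -/
theorem hyperbolic_swap₂₃ {p q r : ℕ} (h : Hyp(p, q, r)) : Hyp(p, r, q) := by
  have e1 : r * q + q * p + p * r = q * r + r * p + p * q := by ring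
  have e2 : p * r * q = p * q * r := by ring
  rw [e1, e2]; exact h

/-- Minimality for coordinatewise divisibility is symmetric: `Min(p, q, r) ⇒ Min(q, p, r)`. [folklore] -/
theorem minimal_swap₁₂ {p q r : ℕ} (h : Min(p, q, r)) : Min(q, p, r) := by
  intro p' q' r' hp' hq' hr' hH
  obtain ⟨h1, h2, h3⟩ := h q' p' r' hq' hp' hr' (hyperbolic_swap₁₂ hH)
  exact ⟨h2, h1, h3⟩

/-- Minimality for coordinatewise divisibility is symmetric: `Min(p, q, r) ⇒ Min(p, r, q)`. [folklore] -/
theorem minimal_swap₂₃ {p q r : ℕ} (h : Min(p, q, r)) : Min(p, r, q) := by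
  intro p' q' r' hp' hq' hr' hH
  obtain ⟨h1, h2, h3⟩ := h p' r' q' hp' hr' hq' (hyperbolic_swap₂₃ hH)
  exact ⟨h1, h3, h2⟩

/-- **Sorting.** A property of signatures that is established for all sorted hyperbolic minimal
signatures `p ≤ q ≤ r`, namely `FinAll`, holds for every hyperbolic minimal signature: the three
predicates are transported along the transpositions `(1 2)`, `(2 3)`, which generate all permutations.
[folklore] -/
theorem forall_finite_properSolutions_of_sorted
    (h : ∀ p q r : ℕ, p ≤ q → q ≤ r → Hyp(p, q, r) → Min(p, q, r) → FinAll(p, q, r))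
    {p q r : ℕ} (hH : Hyp(p, q, r)) (hM : Min(p, q, r)) : FinAll(p, q, r) := by
  rcases le_total p q with hpq | hqp <;> rcases le_total q r with hqr | hrq <;>
    rcases le_total p r with hpr | hrp
  · -- `p ≤ q ≤ r`
    exact h p q r hpq hqr hH hM
  · -- `p ≤ q ≤ r` again (`r ≤ p ≤ q ≤ r`)
    exact h p q r hpq hqr hH hM
  · -- `p ≤ r ≤ q`: sorted `(p, r, q)`
    exact forall_finite_properSolutions_swap₂₃
      (h p r q hpr hrq (hyperbolic_swap₂₃ hH) (minimal_swap₂₃ hM))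
  · -- `r ≤ p ≤ q`: sorted `(r, p, q) = (1 2) (2 3) (p, q, r)`
    exact forall_finite_properSolutions_swap₂₃ (forall_finite_properSolutions_swap₁₂
      (h r p q hrp hpq (hyperbolic_swap₁₂ (hyperbolic_swap₂₃ hH))
        (minimal_swap₁₂ (minimal_swap₂₃ hM))))
  · -- `q ≤ p ≤ r`: sorted `(q, p, r)`
    exact forall_finite_properSolutions_swap₁₂
      (h q p r hqp hpr (hyperbolic_swap₁₂ hH) (minimal_swap₁₂ hM))
  · -- `q ≤ r ≤ p`: sorted `(q, r, p) = (2 3) (1 2) (p, q, r)`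
    exact forall_finite_properSolutions_swap₁₂ (forall_finite_properSolutions_swap₂₃
      (h q r p hqr hrp (hyperbolic_swap₂₃ (hyperbolic_swap₁₂ hH))
        (minimal_swap₂₃ (minimal_swap₁₂ hM))))
  · -- `r ≤ q ≤ p ≤ r`: all equal, sorted already
    exact h p q r (by omega) (by omega) hH hM
  · -- `r ≤ q ≤ p`: sorted `(r, q, p) = (1 2) (2 3) (1 2) (p, q, r)`
    exact forall_finite_properSolutions_swap₁₂ (forall_finite_properSolutions_swap₂₃
      (forall_finite_properSolutions_swap₁₂
        (h r q p hrq hqp (hyperbolic_swap₁₂ (hyperbolic_swap₂₃ (hyperbolic_swap₁₂ hH)))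
          (minimal_swap₁₂ (minimal_swap₂₃ (minimal_swap₁₂ hM))))))

end Permutations

/-! ### C. Minimal hyperbolic signatures -/

section Minimal

/-- **Every hyperbolic signature is divisible by a minimal one**: among the hyperbolic `(p', q', r')`
with `p' ∣ p`, `q' ∣ q`, `r' ∣ r` take one with `p' + q' + r'` least. [folklore] -/
theorem exists_minimal_hyperbolic_dvd {p q r : ℕ} (h : Hyp(p, q, r)) :
    ∃ p' q' r' : ℕ, p' ∣ p ∧ q' ∣ q ∧ r' ∣ r ∧ Hyp(p', q', r') ∧ Min(p', q', r') := by
  classical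
  have hex : ∃ s : ℕ, ∃ p' q' r' : ℕ, p' ∣ p ∧ q' ∣ q ∧ r' ∣ r ∧ Hyp(p', q', r') ∧
      p' + q' + r' = s :=
    ⟨_, p, q, r, dvd_rfl, dvd_rfl, dvd_rfl, h, rfl⟩
  obtain ⟨p', q', r', hp', hq', hr', hH, hs⟩ := Nat.find_spec hex
  refine ⟨p', q', r', hp', hq', hr', hH, fun d₁ d₂ d₃ hd₁ hd₂ hd₃ hHd => ?_⟩
  obtain ⟨h1, h2, h3⟩ := hyperbolic_exponents_ne_zero hH
  have hle : Nat.find hex ≤ d₁ + d₂ + d₃ :=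
    Nat.find_min' hex ⟨d₁, d₂, d₃, hd₁.trans hp', hd₂.trans hq', hd₃.trans hr', hHd, rfl⟩
  have l1 := Nat.le_of_dvd (Nat.pos_of_ne_zero h1) hd₁
  have l2 := Nat.le_of_dvd (Nat.pos_of_ne_zero h2) hd₂
  have l3 := Nat.le_of_dvd (Nat.pos_of_ne_zero h3) hd₃
  omega

end Minimal

/-! ### D. One signature: a `(p, q, r)` covering and Faltings' theorem give finiteness -/

section OneSignature


variable {K : Type} [Field K] [NumberField K]

/-- The finite places of `K` dividing a fixed non-zero integer are finitely many (private copy of the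
private helper of `AbcDarmonGranvilleBelyiMapReduction`, not exported there). [folklore] -/
private theorem finite_setOf_intCast_mem_asIdeal_aux {N : ℤ} (hN : N ≠ 0) :
    {v : HeightOneSpectrum (𝓞 K) | (N : 𝓞 K) ∈ v.asIdeal}.Finite := by
  have hN' : Ideal.span {(N : 𝓞 K)} ≠ ⊥ := by
    rw [Ne, Ideal.span_singleton_eq_bot]
    exact Int.cast_ne_zero.mpr hN
  refine (Ideal.finite_factors hN').subset fun v hv => ?_
  simpa [Ideal.dvd_span_singleton] using hv

variable {F : Type} [Field F] [Algebra K F] [IsAlgFunctionField K F] [IsIntegrallyClosedIn K F]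

/-- **Darmon–Granville's Theorem 2 at ONE signature, from a `(p, q, r)` covering and Faltings'
theorem.** Let `(p, q, r)` be hyperbolic, `K` a number field, `F/K` an algebraic function field with
full constant field `K` and `f ∈ F ∖ K` with every zero of order `p`, every zero of `f - 1` of order `q`,
every pole of order `r`, and `F/K(f)` unramified over every closed point `π₀ ∉ {X, X - 1}` of the affine
`f`-line; grant Faltings' theorem (`finite_ratPlaces_of_two_le_genus`, every function field over a
number field). Then for all non-zero `A, B, C` the proper solutions of `A x^p + B y^q = C z^r` are finitely
many. This is the body of `darmonGranville1995_thm_2_of_belyiMap_of_faltings` run at a single signature: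
reduce to the parameters `t = A x^p / C z^r` (`finite_properSolutions_coeffParam_eq`,
`finite_properSolutions_trivial`), `g ≥ 2` by `two_le_genus_of_hyperbolic_signature`, the bad set `V`
of Beckmann's theorem `beckmann_specialization_of_signature`, the congruences (3.1) at `v ∤ A B C`, and
the Hermite–Minkowski + compositum + Faltings count
`finite_of_fibres_isUnramifiedAt_of_finite_ratPlaces`.
[cite: DarmonGranville1995, Theorem 2 (p. 515); proof, pp. 526–527]
[cite: BombieriGubler2006, Thm. 12.6.15 (proof)] -/
theorem finite_properSolutions_of_belyiMap_of_faltings {p q r : ℕ}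
    (hpqr : q * r + r * p + p * q < p * q * r) {f : F} (hf : f ∉ Set.range (algebraMap K F))
    (h₀ : ∀ P : PlaceOver K F, 0 < P.ord f → P.ord f = p)
    (h₁ : ∀ P : PlaceOver K F, 0 < P.ord (f - 1) → P.ord (f - 1) = q)
    (hi : ∀ P : PlaceOver K F, P.ord f < 0 → P.ord f = -r)
    (hunr : ∀ π₀ : K[X], Irreducible π₀ → π₀.Monic → π₀ ≠ X → π₀ ≠ X - 1 →
      ∀ P : PlaceOver K F, 0 < P.ord (aeval f π₀) → P.ord (aeval f π₀) = 1)
    (hFaltings : ∀ (K' : Type) [Field K'] (F' : Type) [Field F'] [Algebra K' F'],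
      finite_ratPlaces_of_two_le_genus K' F')
    {A B C : ℤ} (hA : A ≠ 0) (hB : B ≠ 0) (hC : C ≠ 0) :
    {t : ℤ × ℤ × ℤ | ({t.1, t.2.1, t.2.2} : Finset ℤ).gcd id = 1 ∧
      A * t.1 ^ p + B * t.2.1 ^ q = C * t.2.2 ^ r}.Finite := by
  obtain ⟨hp, hq, hr⟩ := hyperbolic_exponents_ne_zero hpqr
  -- reduce to the finiteness of the parameters `t = A x^p / C z^r` of the solutions with `x y z ≠ 0`
  suffices hT : ((fun t : ℤ × ℤ × ℤ => (A : ℚ) * (t.1 : ℚ) ^ p / ((C : ℚ) * (t.2.2 : ℚ) ^ r)) ''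
      {t : ℤ × ℤ × ℤ | ({t.1, t.2.1, t.2.2} : Finset ℤ).gcd id = 1 ∧
        A * t.1 ^ p + B * t.2.1 ^ q = C * t.2.2 ^ r ∧ t.1 * t.2.1 * t.2.2 ≠ 0}).Finite by
    have hN : {t : ℤ × ℤ × ℤ | ({t.1, t.2.1, t.2.2} : Finset ℤ).gcd id = 1 ∧
        A * t.1 ^ p + B * t.2.1 ^ q = C * t.2.2 ^ r ∧ t.1 * t.2.1 * t.2.2 ≠ 0}.Finite :=
      (hT.biUnion fun v _ => finite_properSolutions_coeffParam_eq hA hB hC hp hq hr v).subset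
        fun t ht => Set.mem_biUnion (Set.mem_image_of_mem _ ht) ⟨ht.1, ht.2.1, ht.2.2, rfl⟩
    refine (hN.union (finite_properSolutions_trivial hA hB hC hp hq hr)).subset fun t ht => ?_
    by_cases h0 : t.1 * t.2.1 * t.2.2 = 0
    · exact Or.inr ⟨ht.1, ht.2, h0⟩
    · exact Or.inl ⟨ht.1, ht.2, h0⟩
  -- Prop. 12.6.9 over `K` itself: `g ≥ 2`; Prop. 3.2: the bad places `V`
  have hg : 2 ≤ genus K F := two_le_genus_of_hyperbolic_signature hf hpqr h₀ h₁ hi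
  obtain ⟨V, hV, hBeck⟩ := beckmann_specialization_of_signature K F f p q r hf h₀ h₁ hi hunr
  -- move the parameters into `K`
  have hinj : Function.Injective (algebraMap ℚ K) := (algebraMap ℚ K).injective
  refine Set.Finite.of_finite_image (f := algebraMap ℚ K) ?_ hinj.injOn
  -- `V_{ABC}`: `V` and the places dividing `A B C`
  have hABC : A * B * C ≠ 0 := mul_ne_zero (mul_ne_zero hA hB) hC
  refine finite_of_fibres_isUnramifiedAt_of_finite_ratPlaces hf hg (fun φ _ => hFaltings _ _)
    (hV.union (finite_setOf_intCast_mem_asIdeal_aux (K := K) hABC)) ?_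
  rintro _ ⟨_, ⟨⟨x, y, z⟩, ⟨hgcd, he, h0⟩, rfl⟩, rfl⟩
  dsimp only at hgcd he h0 ⊢
  have hx : x ≠ 0 := fun h => h0 (by rw [h, zero_mul, zero_mul])
  have hy : y ≠ 0 := fun h => h0 (by rw [h, mul_zero, zero_mul])
  have hz : z ≠ 0 := fun h => h0 (by rw [h, mul_zero])
  -- the parameter `t = A x^p / C z^r ∈ K ∖ {0, 1}`
  have ht : algebraMap ℚ K ((A : ℚ) * (x : ℚ) ^ p / ((C : ℚ) * (z : ℚ) ^ r)) =
      (A : K) * (x : K) ^ p / ((C : K) * (z : K) ^ r) := by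
    rw [map_div₀, map_mul, map_mul, map_pow, map_pow]
    simp
  rw [ht]
  have ht0 : (A : K) * (x : K) ^ p / ((C : K) * (z : K) ^ r) ≠ 0 := by
    rw [← ht, _root_.map_ne_zero]
    exact coeffParam_ne_zero hA hC hx hz p r
  have ht1 : (A : K) * (x : K) ^ p / ((C : K) * (z : K) ^ r) ≠ 1 := by
    rw [← ht, ← (algebraMap ℚ K).map_one, hinj.ne_iff]
    exact coeffParam_ne_one hB hC hy hz he
  -- a point `P ∈ π⁻¹(t)`; `K(P)/K` is unramified outside `V_{ABC}` by (3.1) and Prop. 3.2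
  obtain ⟨P, hP⟩ := exists_ord_pos_of_transcendental
    (transcendental_of_not_mem_range (sub_algebraMap_not_mem_range hf _))
  refine ⟨P, hP, fun v hv 𝔓 _ h𝔓 => ?_⟩
  simp only [Set.mem_union, Set.mem_setOf_eq, not_or] at hv
  exact hBeck _ ht0 ht1 v hv.1 (dvd_interZero_coeffParam_place v hp hr hv.2 hgcd he hx hz)
    (dvd_interOne_coeffParam_place v hq hr hv.2 hgcd he hy hz)
    (dvd_interInfty_coeffParam_place v hp hr hv.2 hgcd he hx hz) P hP 𝔓 h𝔓

end OneSignature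

/-! ### E. Theorem 2 from coverings for the minimal sorted signatures only -/

section Assembly

/-- **Darmon–Granville 1995, Theorem 2, from `(p, q, r)` coverings for the MINIMAL sorted hyperbolic
signatures and Faltings' theorem.** Suppose that for every hyperbolic `(p, q, r)` with `p ≤ q ≤ r`
which is minimal for coordinatewise divisibility (every hyperbolic `(p', q', r')` with `p' ∣ p`,
`q' ∣ q`, `r' ∣ r` equals `(p, q, r)`) there are a number field `K`, an algebraic function field `F/K`
with full constant field `K` and `f ∈ F ∖ K` with every zero of order `p`, every zero of `f - 1` of
order `q`, every pole of order `r`, and `F/K(f)` unramified over the other closed points of the `f`-line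
(the covering of [cite: DarmonGranville1995, Prop. 3.1 (p. 525)], [cite: BombieriGubler2006,
Cor. 12.6.7 and 12.6.8, first sentence], there from the Riemann existence theorem), and grant Faltings'
theorem (`finite_ratPlaces_of_two_le_genus`, every function field over a number field). Then
`A x^p + B y^q = C z^r` has finitely many proper solutions for every hyperbolic `(p, q, r)` and all
non-zero `A, B, C` ([cite: DarmonGranville1995, Theorem 2 (p. 515)]). Proof: a hyperbolic `(p, q, r)`
is divisible by a minimal hyperbolic `(p', q', r')` (`exists_minimal_hyperbolic_dvd`); sort it
(`forall_finite_properSolutions_of_sorted`), apply the one-signature theorem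
`finite_properSolutions_of_belyiMap_of_faltings`, and come back by `finite_properSolutions_of_dvd`.
[cite: DarmonGranville1995, Theorem 2 (p. 515); Prop. 3.1 (p. 525); proof, pp. 526–527] -/
theorem darmonGranville1995_thm_2_of_minimal_belyiMaps_of_faltings
    (hCover : ∀ p q r : ℕ, p ≤ q → q ≤ r → q * r + r * p + p * q < p * q * r →
      (∀ p' q' r' : ℕ, p' ∣ p → q' ∣ q → r' ∣ r → q' * r' + r' * p' + p' * q' < p' * q' * r' →
        p' = p ∧ q' = q ∧ r' = r) →
      ∃ (K : Type) (_ : Field K) (_ : NumberField K) (F : Type) (_ : Field F) (_ : Algebra K F)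
        (_ : IsAlgFunctionField K F) (_ : IsIntegrallyClosedIn K F) (f : F),
        f ∉ Set.range (algebraMap K F) ∧
        (∀ P : PlaceOver K F, 0 < P.ord f → P.ord f = p) ∧
        (∀ P : PlaceOver K F, 0 < P.ord (f - 1) → P.ord (f - 1) = q) ∧
        (∀ P : PlaceOver K F, P.ord f < 0 → P.ord f = -r) ∧
        (∀ π₀ : K[X], Irreducible π₀ → π₀.Monic → π₀ ≠ X → π₀ ≠ X - 1 →
          ∀ P : PlaceOver K F, 0 < P.ord (aeval f π₀) → P.ord (aeval f π₀) = 1))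
    (hFaltings : ∀ (K' : Type) [Field K'] (F' : Type) [Field F'] [Algebra K' F'],
      finite_ratPlaces_of_two_le_genus K' F') :
    darmonGranville1995_thm_2 := by
  -- the sorted minimal signatures, by the one-signature theorem
  have hsorted : ∀ p q r : ℕ, p ≤ q → q ≤ r → Hyp(p, q, r) → Min(p, q, r) → FinAll(p, q, r) := by
    intro p q r hpq hqr hH hM A B C hA hB hC
    obtain ⟨K, _, _, F, _, _, _, _, f, hf, h₀, h₁, hi, hunr⟩ := hCover p q r hpq hqr hH hM
    exact finite_properSolutions_of_belyiMap_of_faltings hH hf h₀ h₁ hi hunr hFaltings hA hB hC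
  intro A B C hA hB hC p q r hpqr
  obtain ⟨hp, hq, hr⟩ := hyperbolic_exponents_ne_zero hpqr
  -- a minimal hyperbolic signature dividing `(p, q, r)`
  obtain ⟨p', q', r', hp', hq', hr', hH', hM'⟩ := exists_minimal_hyperbolic_dvd hpqr
  exact finite_properSolutions_of_dvd hp' hq' hr' hp hq hr
    (forall_finite_properSolutions_of_sorted hsorted hH' hM' A B C hA hB hC)

/-- **The record `darmon_granville` (abc.S18) from coverings for the minimal sorted signatures and
Faltings' theorem**, through `darmon_granville_of_darmonGranville1995_thm_2`.
[cite: DarmonGranville1995, Theorem 2 (p. 515)] -/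
theorem darmon_granville_of_minimal_belyiMaps_of_faltings
    (hCover : ∀ p q r : ℕ, p ≤ q → q ≤ r → q * r + r * p + p * q < p * q * r →
      (∀ p' q' r' : ℕ, p' ∣ p → q' ∣ q → r' ∣ r → q' * r' + r' * p' + p' * q' < p' * q' * r' →
        p' = p ∧ q' = q ∧ r' = r) →
      ∃ (K : Type) (_ : Field K) (_ : NumberField K) (F : Type) (_ : Field F) (_ : Algebra K F)
        (_ : IsAlgFunctionField K F) (_ : IsIntegrallyClosedIn K F) (f : F),
        f ∉ Set.range (algebraMap K F) ∧
        (∀ P : PlaceOver K F, 0 < P.ord f → P.ord f = p) ∧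
        (∀ P : PlaceOver K F, 0 < P.ord (f - 1) → P.ord (f - 1) = q) ∧
        (∀ P : PlaceOver K F, P.ord f < 0 → P.ord f = -r) ∧
        (∀ π₀ : K[X], Irreducible π₀ → π₀.Monic → π₀ ≠ X → π₀ ≠ X - 1 →
          ∀ P : PlaceOver K F, 0 < P.ord (aeval f π₀) → P.ord (aeval f π₀) = 1))
    (hFaltings : ∀ (K' : Type) [Field K'] (F' : Type) [Field F'] [Algebra K' F'],
      finite_ratPlaces_of_two_le_genus K' F') :
    darmon_granville :=
  darmon_granville_of_darmonGranville1995_thm_2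
    (darmonGranville1995_thm_2_of_minimal_belyiMaps_of_faltings hCover hFaltings)

end Assembly

end Literature.NumberTheory.DiophantineGeometry
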